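import Summits.CriticalPhenomena.PercolationContinuityZ3.Theorems.PercNearOneGluingNoHeavyQuantLawDEC
import HarnessLib

/-!
# QUANT lane R8, T-DEC: law-level closure tools, part I — the SHIFT LEMMA: DEC(j′) of `ν` gives DEC(j′+s) of `ν` shifted up by `s`

builds on p205010 (kernel theorem, internal audit signed; external expert review pending)

Support file (`--supports stmt-CriticalPhenomena-4575`), QUANT lane seat prim-quant-census-2 (gen 53), rung R8 of
`run/shared/lean/prim/quant/LADDER.md`.  Memo `run/shared/lean/prim/quant/prim-quant-census-2-g53/DEC-CLOSURE-G53.md` §3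
(the closure programme: DEC-at-all-layers under convolution / one-blob slices; the shift is the sure-blob case and the tool that
decomposes the "blob on" row).  Theorems only (no definitions), standard axioms.

* **`LawDec.decAt_shift`.**  If the law `ν` on `{0..M}` (vanishing above `M`, mass 1) is DEC(j′) at floor `x` (`Quant.LawDec.DECAt x j′ M ν`),
  then for every `s` the shifted law `h ↦ ν (h − s)·[s ≤ h]` on `{0..M+s}` is DEC(j′+s) at floor `x`: shift every component
  `{lo, hi; g} ↦ {lo+s, hi+s; g}`.  The shifted law has mean `T + s`; a self-sufficient point `2k ≥ T` becomes `2(k+s) ≥ T + 2s ≥ T + s`,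
  a giant pair stays giant (`hi + s ≥ j′+s+1`, same gate), a credit pair gains `2s ≥ s` of credit (`lo ↦ lo + s`, same `hi − lo`, same
  rate).  (The surplus `s` is what the convolution / slice closure spends; `DECAt` records validity at the law's own mean.)
* `LawDec.sum_mul_shift` — the first-moment bookkeeping `Σ_{h ≤ M+s} h·ν(h−s)[s ≤ h] = Σ_{k ≤ M} k·ν k + s`.

[this work]; DEC rules ARCH-TREES-G49 §2.2 / DEC-TAMP-G50 §3.1 (this lane).  The gluing rows served
[cite: KozmaNitzan2024, Conjecture 3 (p. 15)]; product measure [cite: Grimmett1999, §1.3 p. 10].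
-/

noncomputable section

namespace Summit.CriticalPhenomena.PercolationContinuityZ3.Theorems

namespace Quant

open Finset

/-- the two-point law `{lo, hi; g}` (as in `…QuantLawDEC`) -/
local notation3 "TP[" lo ", " hi ", " g ", " h "]" =>
  (g : ℝ) * (if (h : ℕ) = (hi : ℕ) then (1 : ℝ) else 0) + (1 - (g : ℝ)) * (if (h : ℕ) = (lo : ℕ) then (1 : ℝ) else 0)

namespace LawDec

/-- **First moment of a shifted law**: `Σ_{h < M+s+1} h·(ν(h−s)·[s ≤ h]) = Σ_{k < M+1} k·ν k + s·Σ_{k < M+1} ν k`. [folklore] -/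
theorem sum_mul_shift (ν : ℕ → ℝ) (M s : ℕ) :
    ∑ h ∈ Finset.range (M + s + 1), (h : ℝ) * (if s ≤ h then ν (h - s) else 0)
      = ∑ k ∈ Finset.range (M + 1), (k : ℝ) * ν k + (s : ℝ) * ∑ k ∈ Finset.range (M + 1), ν k := by
  have hsplit : ∑ h ∈ Finset.range (M + s + 1), (h : ℝ) * (if s ≤ h then ν (h - s) else 0)
      = ∑ h ∈ Finset.Ico 0 s, (h : ℝ) * (if s ≤ h then ν (h - s) else 0)
        + ∑ h ∈ Finset.Ico s (M + s + 1), (h : ℝ) * (if s ≤ h then ν (h - s) else 0) := by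
    rw [Finset.range_eq_Ico, Finset.sum_Ico_consecutive _ (Nat.zero_le s) (by omega)]
  have hzero : ∑ h ∈ Finset.Ico 0 s, (h : ℝ) * (if s ≤ h then ν (h - s) else 0) = 0 := by
    refine Finset.sum_eq_zero fun h hh => ?_
    rw [Finset.mem_Ico] at hh
    rw [if_neg (by omega), mul_zero]
  have hre : ∑ h ∈ Finset.Ico s (M + s + 1), (h : ℝ) * (if s ≤ h then ν (h - s) else 0)
      = ∑ k ∈ Finset.range (M + 1), ((s + k : ℕ) : ℝ) * ν k := by
    rw [Finset.sum_Ico_eq_sum_range, show M + s + 1 - s = M + 1 by omega]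
    refine Finset.sum_congr rfl fun k _ => ?_
    rw [if_pos (Nat.le_add_right s k), Nat.add_sub_cancel_left]
  rw [hsplit, hzero, zero_add, hre, Finset.mul_sum, ← Finset.sum_add_distrib]
  refine Finset.sum_congr rfl fun k _ => ?_
  push_cast
  ring

/-- **THE SHIFT LEMMA.**  DEC(j′) for `ν` on `{0..M}` ⟹ DEC(j′+s) for the law `ν` shifted up by `s` (on `{0..M+s}`), same floor.
See the file header. [this work] -/
theorem decAt_shift (x : ℝ) (j' M s : ℕ) (ν : ℕ → ℝ)
    (hν1 : ∑ h ∈ Finset.range (M + 1), ν h = 1) (hdec : DECAt x j' M ν) :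
    DECAt x (j' + s) (M + s) (fun h => if s ≤ h then ν (h - s) else 0) := by
  classical
  obtain ⟨ρ, hρ, lam, g, lo, hi, h0, h1, hg, hlohi, hhi, hν, hval⟩ := hdec
  refine ⟨ρ, hρ, lam, g, fun r => lo r + s, fun r => hi r + s, h0, h1, hg, fun r => Nat.add_le_add_right (hlohi r) s,
    fun r => Nat.add_le_add_right (hhi r) s, fun h => ?_, fun r hr => ?_⟩
  · -- the shifted law is the mixture of the shifted components
    show (if s ≤ h then ν (h - s) else 0) = ∑ r, lam r * TP[lo r + s, hi r + s, g r, h]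
    by_cases hs : s ≤ h
    · rw [if_pos hs, hν (h - s)]
      refine Finset.sum_congr rfl fun r _ => ?_
      have e1 : (h - s = hi r) ↔ (h = hi r + s) := by omega
      have e2 : (h - s = lo r) ↔ (h = lo r + s) := by omega
      simp only [e1, e2]
    · rw [if_neg hs]
      symm
      refine Finset.sum_eq_zero fun r _ => ?_
      rw [if_neg (by omega), if_neg (by omega)]
      ring
  · -- validity at the shifted mean `T + s` and layer `j′ + s`
    show ValidAt x _ (j' + s) (lo r + s) (hi r + s) (g r)
    rw [sum_mul_shift ν M s, hν1, mul_one]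
    set T : ℝ := ∑ k ∈ Finset.range (M + 1), (k : ℝ) * ν k with hT
    rcases hval r hr with ⟨heq, hS⟩ | ⟨hlt, hgi, hxg⟩ | ⟨hlt, hhij, hcr⟩
    · refine Or.inl ⟨by rw [heq], ?_⟩
      rcases hS with h2 | h2
      · left; push_cast; linarith
      · right; omega
    · exact Or.inr (Or.inl ⟨by omega, by omega, hxg⟩)
    · refine Or.inr (Or.inr ⟨by omega, by omega, ?_⟩)
      have hrate : (if x ≤ g r then g r else (g r - x ^ 2) / (1 - x)) * (((hi r + s : ℕ) : ℝ) - ((lo r + s : ℕ) : ℝ))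
          = (if x ≤ g r then g r else (g r - x ^ 2) / (1 - x)) * ((hi r : ℝ) - (lo r : ℝ)) := by
        push_cast; ring
      have hs0 : (0 : ℝ) ≤ s := Nat.cast_nonneg s
      push_cast
      nlinarith [hcr, hrate, hs0]

end LawDec

end Quant

end Summit.CriticalPhenomena.PercolationContinuityZ3.Theorems
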